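import Mathlib
import Literature.MathematicalPhysics.QuantumFieldTheory.YangMillsOS
import HarnessLib

/-!
# Crux `FiniteSusceptibilityWeakCoupling` (stmt-QuantumFields-9442), line `purity-rate-split` —
# stub `stub_simpleRepDetOne`: lattice representations of a compact simple `G` land in `SU(N)`

Skeleton line `purity-rate-split` of the crux
`Summit.QuantumFields.YangMills.Theses.FradkinShenkerFlow.FiniteSusceptibilityWeakCoupling` splits the
weak-coupling finite-susceptibility input of 4-d lattice Yang–Mills for a compact simple gauge group `G` into a
purity half and a rate half; the rate half fails for `U(1)` in `d = 4` because the `C`-odd plaquette observable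
`Im tr U_p` couples linearly to the massless photon. For simple `G` this failure mode has to be excluded by group
theory, and the first lemma of that exclusion is the registered stub proved here:

* `stub_simpleRepDetOne` — if `G` is a compact simple Lie group in the tree sense
  (`IsCompactSimpleLieGroup G`: connected, non-abelian, every closed preconnected normal subgroup is `⊥` or
  `⊤`, and a faithful continuous unitary matrix representation exists), then every lattice representation
  `r : LatticeRep G` satisfies `det (r.ρ g) = 1` for all `g`, i.e. `r.ρ` lands in `SU(r.N)` ("simple ⇒ no
  non-trivial continuous character").

Proof (elementary topological group theory, no Lie theory, no measure theory). Let
`χ := det ∘ r.ρ : G →* ℂ` (continuous) and `H := closure [G, G]`, the topological closure of the commutator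
subgroup. `H` is normal and closed; it is preconnected because `[G, G]` is generated by the commutator orbits
`{⁅g, y⁆ | g ∈ G}`, continuous images of the connected space `G` through `1 = ⁅1, y⁆`, so every element of
`[G, G]` is joined to `1` inside `[G, G]` by a preconnected set (closure induction), and closures of preconnected
sets are preconnected. By simplicity `H = ⊥` or `H = ⊤`. If `H = ⊥` then `⁅a, b⁆ = 1` for all `a, b`, i.e. `G`
is abelian — excluded. If `H = ⊤` then, since `χ` takes values in the commutative monoid `ℂ`, it kills every
commutator (`χ ⁅p, q⁆ = (χ p · χ p⁻¹)(χ q · χ q⁻¹) = 1`), so `[G, G] ≤ ker χ`; `ker χ = χ⁻¹{1}` is closed, hence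
`⊤ = H ≤ ker χ`, i.e. `det (r.ρ g) = 1` for every `g`.

Helper lemmas live in the sub-namespace `SimpleRepDetOne`. Mathlib only; no named unproved facts are used.
-/

set_option autoImplicit false

noncomputable section

open scoped commutatorElement
open Literature.MathematicalPhysics.QuantumFieldTheory Literature.MathematicalPhysics.QuantumLattice

namespace Summit.QuantumFields.YangMills.Theorems.FiniteSusceptibilityWeakCoupling

namespace SimpleRepDetOne

variable {G : Type*} [Group G]

/-- A monoid homomorphism from a group to a *commutative* monoid kills commutators:
`χ ⁅p, q⁆ = (χ p · χ p⁻¹) · (χ q · χ q⁻¹) = 1` (no invertibility of `χ p` is needed). [folklore] -/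
theorem map_commutatorElement_eq_one {M : Type*} [CommMonoid M] (χ : G →* M) (p q : G) :
    χ ⁅p, q⁆ = 1 := by
  have hp : χ p * χ p⁻¹ = 1 := by rw [← map_mul, mul_inv_cancel, map_one]
  have hq : χ q * χ q⁻¹ = 1 := by rw [← map_mul, mul_inv_cancel, map_one]
  calc χ ⁅p, q⁆ = χ p * χ p⁻¹ * (χ q * χ q⁻¹) := by
        rw [commutatorElement_def, map_mul, map_mul, map_mul, mul_right_comm (χ p) (χ q) (χ p⁻¹),
          mul_assoc (χ p * χ p⁻¹) (χ q) (χ q⁻¹)]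
    _ = 1 := by rw [hp, hq, mul_one]

/-- The commutator subgroup lies in the kernel of every monoid homomorphism to a commutative monoid.
[folklore] -/
theorem commutator_le_ker {M : Type*} [CommMonoid M] (χ : G →* M) : commutator G ≤ χ.ker := by
  rw [commutator_eq_closure, Subgroup.closure_le]
  rintro _ ⟨p, q, rfl⟩
  exact (MonoidHom.mem_ker).2 (map_commutatorElement_eq_one χ p q)

variable [TopologicalSpace G]

/-- **The commutator subgroup of a connected topological group is preconnected**: every element of
`[G, G] = ⟨⁅p, q⁆⟩` is joined to `1` inside `[G, G]` by a preconnected subset, built from the commutator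
orbits `{⁅g, y⁆ | g ∈ G}` (continuous images of the connected space `G`, through `⁅1, y⁆ = 1`) by left
translation, inversion and union. [folklore] -/
theorem isPreconnected_commutator [IsTopologicalGroup G] [ConnectedSpace G] :
    IsPreconnected ((commutator G : Subgroup G) : Set G) := by
  -- adapted from Literature/RepresentationTheory/CompactGroups/NormalSubgroupsFromDerivations.lean,
  -- theorem `isPreconnected_flowSubgroup` (closure induction + `isPreconnected_of_forall`)
  rw [commutator_eq_closure]
  set H := Subgroup.closure (commutatorSet G) with hH
  -- every element is joined to `1` by a preconnected subset of `H`
  have key : ∀ x ∈ H, ∃ C : Set G, C ⊆ H ∧ IsPreconnected C ∧ (1 : G) ∈ C ∧ x ∈ C := by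
    intro x hx
    refine Subgroup.closure_induction
      (p := fun x _ => ∃ C : Set G, C ⊆ H ∧ IsPreconnected C ∧ (1 : G) ∈ C ∧ x ∈ C)
      (fun x hx => ?_) ⟨{1}, by simp [hH], isPreconnected_singleton, rfl, rfl⟩
      (fun x y _ _ hx hy => ?_) (fun x _ hx => ?_) hx
    · obtain ⟨a, b, rfl⟩ := hx
      have hcont : Continuous fun g : G => ⁅g, b⁆ := by
        simp only [commutatorElement_def]
        fun_prop
      refine ⟨Set.range fun g : G => ⁅g, b⁆, ?_, isPreconnected_range hcont,
        ⟨1, commutatorElement_one_left b⟩, ⟨a, rfl⟩⟩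
      rintro _ ⟨g, rfl⟩
      exact Subgroup.subset_closure (commutator_mem_commutatorSet g b)
    · obtain ⟨Cx, hCxH, hCx, h1x, hxx⟩ := hx
      obtain ⟨Cy, hCyH, hCy, h1y, hyy⟩ := hy
      refine ⟨Cx ∪ (fun z => x * z) '' Cy, ?_, ?_, Or.inl h1x, Or.inr ⟨y, hyy, rfl⟩⟩
      · rintro z (hz | ⟨w, hw, rfl⟩)
        · exact hCxH hz
        · exact H.mul_mem (hCxH hxx) (hCyH hw)
      · exact IsPreconnected.union x hxx ⟨1, h1y, mul_one x⟩ hCx (hCy.image _ (by fun_prop))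
    · obtain ⟨Cx, hCxH, hCx, h1x, hxx⟩ := hx
      refine ⟨(fun z => z⁻¹) '' Cx, ?_, hCx.image _ (by fun_prop), ⟨1, h1x, inv_one⟩, ⟨x, hxx, rfl⟩⟩
      rintro _ ⟨w, hw, rfl⟩
      exact H.inv_mem (hCxH hw)
  refine isPreconnected_of_forall (1 : G) fun y hy => ?_
  obtain ⟨C, hCH, hC, h1, hyC⟩ := key y hy
  exact ⟨C, hCH, h1, hyC, hC⟩

/-- The topological closure `closure [G, G]` of the commutator subgroup of a connected topological group
is preconnected. [folklore] -/
theorem isPreconnected_commutator_topologicalClosure [IsTopologicalGroup G] [ConnectedSpace G] :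
    IsPreconnected (((commutator G).topologicalClosure : Subgroup G) : Set G) := by
  rw [Subgroup.topologicalClosure_coe]
  exact isPreconnected_commutator.closure

/-- The kernel of a continuous monoid homomorphism into a `T₁` monoid is closed (`ker χ = χ⁻¹{1}`).
[folklore] -/
theorem isClosed_ker {M : Type*} [MulOneClass M] [TopologicalSpace M] [T1Space M] (χ : G →* M)
    (hχ : Continuous χ) : IsClosed ((χ.ker : Subgroup G) : Set G) := by
  rw [MonoidHom.coe_ker]
  exact isClosed_singleton.preimage hχ

/-- **In a simple compact group every continuous character into a commutative `T₁` topological monoid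
is trivial on the whole group**: `closure [G, G]` is a closed preconnected normal subgroup, hence `⊥`
(excluded: `G` is non-abelian) or `⊤`, and it lies in the closed subgroup `ker χ`. [folklore] -/
theorem map_eq_one_of_isSimpleCompactGroup [IsTopologicalGroup G] (hG : IsSimpleCompactGroup G)
    {M : Type*} [CommMonoid M] [TopologicalSpace M] [T1Space M] (χ : G →* M) (hχ : Continuous χ)
    (g : G) : χ g = 1 := by
  obtain ⟨hconn, ⟨a, b, hab⟩, hnormal⟩ := hG
  obtain hbot | htop := hnormal (commutator G).topologicalClosure inferInstance
    (Subgroup.isClosed_topologicalClosure _) isPreconnected_commutator_topologicalClosure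
  · -- `closure [G, G] = ⊥` forces `G` abelian, contradicting `a * b ≠ b * a`
    have hmem : ⁅a, b⁆ ∈ (commutator G).topologicalClosure :=
      Subgroup.le_topologicalClosure _
        (Subgroup.commutator_mem_commutator (Subgroup.mem_top a) (Subgroup.mem_top b))
    rw [hbot, Subgroup.mem_bot, commutatorElement_eq_one_iff_mul_comm] at hmem
    exact absurd hmem hab
  · have hle : (commutator G).topologicalClosure ≤ χ.ker :=
      Subgroup.topologicalClosure_minimal _ (commutator_le_ker χ) (isClosed_ker χ hχ)
    exact (MonoidHom.mem_ker).1 (hle (htop ▸ Subgroup.mem_top g))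

/-- **Lattice representations of a simple compact group are unimodular**: `det (r.ρ g) = 1`, i.e. `r.ρ`
lands in `SU(r.N)` — the determinant character `det ∘ r.ρ : G →* ℂ` is continuous, so it is trivial by
`map_eq_one_of_isSimpleCompactGroup`. [folklore] -/
theorem det_eq_one_of_isSimpleCompactGroup [IsTopologicalGroup G] (hG : IsSimpleCompactGroup G)
    (r : LatticeRep G) (g : G) : (r.ρ g).det = 1 :=
  map_eq_one_of_isSimpleCompactGroup hG (Matrix.detMonoidHom.comp r.ρ)
    ((continuous_id.matrix_det).comp r.continuous) g

end SimpleRepDetOne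

/-- **Stub `stub_simpleRepDetOne`** (line `purity-rate-split`, crux stmt-QuantumFields-9442): for a compact
simple Lie group `G` (tree sense `IsCompactSimpleLieGroup`) every faithful continuous unitary lattice
representation `r.ρ` has determinant identically `1` — "simple ⇒ no non-trivial continuous character", so the
`U(1)`-type linear coupling of a `C`-odd plaquette observable to a massless abelian mode is unavailable.
Compactness and faithfulness are not used. [folklore] -/
theorem stub_simpleRepDetOne : ∀ (G : Type) [Group G] [TopologicalSpace G] [IsTopologicalGroup G] [CompactSpace G], Literature.MathematicalPhysics.QuantumFieldTheory.IsCompactSimpleLieGroup G → ∀ (r : Literature.MathematicalPhysics.QuantumFieldTheory.LatticeRep G) (g : G), (r.ρ g).det = 1 := by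
  intro G _ _ _ _ hG r g
  exact SimpleRepDetOne.det_eq_one_of_isSimpleCompactGroup hG.1 r g

end Summit.QuantumFields.YangMills.Theorems.FiniteSusceptibilityWeakCoupling

end
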